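import Literature.MathematicalPhysics.QuantumFieldTheory.QCDAsymptoticScalingCouplingDivergence

/-!
# Stub `stub_approxPositiveFormsLargeNf` (crux stmt-QuantumFields-11525, line `birth`) — sanity certificate

NOT a proof of the stub.  Kernel-checked certificate that the stub lives in the junk regime: for `17 ≤ N_f` the
one-loop coefficient `betaCoeff₀ N_f` is negative, the two-loop profile `afBeta N_f Λ a_k → −∞` along every
`a_k → 0⁺`, hence every asymptotically scaling scheme (`QCDScheme.HasAsymptoticScaling`) has `β_k → −∞` and in
particular eventually `β_k < 0` — outside the range `0 ≤ β` of `WilsonQCDSiteReflectionPositivityAP_holds` and of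
`stub_rpOfSymThermal` (stmt-9737, hypothesis `∀ᶠ k, 0 ≤ sch.β k`), the only reflection-positivity inputs of the tree.
The hypotheses `HasAsymptoticScaling` + branch + convergence remain jointly satisfiable for every `N_f`
(`QCDScheme.zeroAF`), so no contradiction among them closes the stub; the gap clause is an honest functional integral.
See `stub_approxPositiveFormsLargeNf-analysis.md` next to this file.
-/

namespace Summit.QuantumFields.QCD.Theorems.ConvergentOSClosure

open Filter Topology
open Literature.MathematicalPhysics.QuantumFieldTheory

/-- `b₀ < 0` for `N_f ≥ 17` (loss of asymptotic freedom). -/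
theorem betaCoeff₀_neg_of_seventeen_le {Nf : ℕ} (hNf : 17 ≤ Nf) : betaCoeff₀ Nf < 0 := by
  unfold betaCoeff₀
  have h : (17 : ℝ) ≤ Nf := by exact_mod_cast hNf
  exact div_neg_of_neg_of_pos (by linarith) (by positivity)

/-- For `N_f ≥ 17` the two-loop profile diverges to `−∞` along every `a_k → 0⁺`
(mirror of `tendsto_afBeta_atTop`, which covers `N_f ≤ 16`). -/
theorem tendsto_afBeta_atBot_of_seventeen_le {Nf : ℕ} (hNf : 17 ≤ Nf) {Λ : ℝ} (hΛ : 0 < Λ) {a : ℕ → ℝ}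
    (ha : ∀ k, 0 < a k) (ha0 : Tendsto a atTop (𝓝 0)) :
    Tendsto (fun k => afBeta Nf Λ (a k)) atTop atBot := by
  have hb₀ : betaCoeff₀ Nf < 0 := betaCoeff₀_neg_of_seventeen_le hNf
  obtain ⟨ℓ, hℓ_def⟩ : ∃ ℓ : ℕ → ℝ, ∀ k, ℓ k = Real.log (1 / (a k ^ 2 * Λ ^ 2)) := ⟨_, fun _ => rfl⟩
  have hℓ : Tendsto ℓ atTop atTop := by
    have h1 : Tendsto (fun k => a k ^ 2 * Λ ^ 2) atTop (𝓝[>] 0) := by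
      refine tendsto_nhdsWithin_iff.mpr ⟨?_, Eventually.of_forall fun k => ?_⟩
      · simpa using (ha0.pow 2).mul_const (Λ ^ 2)
      · have := ha k
        show 0 < a k ^ 2 * Λ ^ 2
        positivity
    have h2 := Real.tendsto_log_atTop.comp h1.inv_tendsto_nhdsGT_zero
    refine h2.congr' (Eventually.of_forall fun k => ?_)
    simp [hℓ_def, one_div]
  have hℓpos : ∀ᶠ k in atTop, 0 < ℓ k := hℓ.eventually_gt_atTop 0
  have hq : Tendsto (fun k => 2 * betaCoeff₀ Nf +
      2 * (betaCoeff₁ Nf / betaCoeff₀ Nf) * (Real.log (ℓ k) / ℓ k)) atTop (𝓝 (2 * betaCoeff₀ Nf)) := by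
    have h1 : Tendsto (fun k => Real.log (ℓ k) / ℓ k) atTop (𝓝 0) :=
      Real.isLittleO_log_id_atTop.tendsto_div_nhds_zero.comp hℓ
    have h2 := (h1.const_mul (2 * (betaCoeff₁ Nf / betaCoeff₀ Nf))).const_add (2 * betaCoeff₀ Nf)
    simpa using h2
  have hprod := hℓ.atTop_mul_neg (by linarith : 2 * betaCoeff₀ Nf < 0) hq
  refine hprod.congr' ?_
  filter_upwards [hℓpos] with k hk
  rw [afBeta, ← hℓ_def k]
  field_simp

/-- `N_f ≥ 17` and asymptotic scaling force `β_k → −∞`. -/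
theorem tendsto_beta_atBot_of_hasAsymptoticScaling_of_seventeen_le {Nf : ℕ} (hNf : 17 ≤ Nf)
    (sch : QCDScheme Nf) (h : sch.HasAsymptoticScaling) : Tendsto sch.β atTop atBot := by
  obtain ⟨Λ, hΛ, hε⟩ := h
  have hA := tendsto_afBeta_atBot_of_seventeen_le hNf hΛ sch.a_pos sch.tendsto_a
  have hε' : ∀ᶠ k in atTop, sch.β k - afBeta Nf Λ (sch.a k) ≤ 1 := by
    have h1 : ∀ᶠ k in atTop, sch.β k - afBeta Nf Λ (sch.a k) ∈ Set.Iio (1 : ℝ) :=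
      hε (Iio_mem_nhds (by norm_num))
    filter_upwards [h1] with k hk
    exact le_of_lt hk
  have h2 := tendsto_atBot_add_right_of_ge' atTop (1 : ℝ) hA hε'
  refine h2.congr' (Eventually.of_forall fun k => ?_)
  show afBeta Nf Λ (sch.a k) + (sch.β k - afBeta Nf Λ (sch.a k)) = sch.β k
  ring

/-- `N_f ≥ 17` and asymptotic scaling: eventually `β_k < 0` (no reflection-positivity fact of the tree applies). -/
theorem eventually_beta_neg_of_hasAsymptoticScaling_of_seventeen_le {Nf : ℕ} (hNf : 17 ≤ Nf)
    (sch : QCDScheme Nf) (h : sch.HasAsymptoticScaling) : ∀ᶠ k in atTop, sch.β k < 0 :=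
  (tendsto_beta_atBot_of_hasAsymptoticScaling_of_seventeen_le hNf sch h).eventually_lt_atBot 0

/-- Non-vacuity of the scaling hypothesis for every `N_f` (including `N_f ≥ 17`): the degenerate scheme. -/
example (Nf : ℕ) : (QCDScheme.zeroAF Nf).HasAsymptoticScaling := QCDScheme.zeroAF_hasAsymptoticScaling

end Summit.QuantumFields.QCD.Theorems.ConvergentOSClosure
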